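import Summits.NavierStokesRegularity.NavierStokesRegularity.Theorems.AdaptedFrequencyFrequencyRigidityRSSPressureMass
import Literature.Analysis.FluidPDE.LocalTypeI
import Literature.Analysis.FluidPDE.PineauVicolRSSProofs
import Literature.Analysis.FluidPDE.PineauVicolCylinderRegularity
import Literature.Analysis.FluidPDE.ClassicalSuitable
import HarnessLib

/-!
# Crux `FrequencyRigidity` (stmt-NavierStokesRegularity-2955), line `scaled-energy-split`:
# decaying rotated self-similar flows are suitable in the unit parabolic ball

Helper file (`--supports stmt-NavierStokesRegularity-2955`; theorems only, sorry-free).  Stub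
`stub_rssDecaySuitableInBall` (leaf C1 of Stub 2 of the line): let `(u, p)` be a classical
solution of the unforced Navier–Stokes system with unit viscosity on `(−∞, 0) × ℝ³` of rotated
self-similar form `u(t) = pvAnsatz α U (t)` (Pineau–Vicol 2026, (1.7)) with a decaying profile
`‖U(y)‖ ≤ C₀/(1+‖y‖)`.  Then for the time gauge `c(t) = p(t, 0) − Q[u(t)](0)` of the pressure,
`(u, p − c)` is a suitable weak solution in the unit parabolic ball `Q((0,0),1) = (−1,0) × B₁`
in the class of Albritton–Barker 2019, Def. 2.1 (`IsSuitableWeakSolutionInBall 1 0`), and the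
scaled energies `A(Q(z,r)) = esssup_t r⁻¹ ∫_{B(x,r)} |u|²` of all parabolic sub-balls
`Q(z,r) ⊆ Q((0,0),1)` are bounded (`cknAEss r z u ≤ M`).

Proof.  The decay of the profile is the Type I bound `‖u(t,x)‖ ≤ C₀/(‖x‖ + √(−t))` for all
`t < 0` (Remark 1.2).  (i) The classical pair is suitable on the open ball (CKN 1982 §2) and the
gauge `c` is locally integrable and locally `L^{3/2}` there (tools file), so `(u, p − c)` is
suitable (`IsSuitableWeakSolutionOn.sub_pressure`).  (ii), (v) The Type I bound gives
`∫_{B(x₀,r)} |u(t)|² ≤ 18|B₁|C₀² r` for every ball and `t < 0`, whence the energy class and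
`A ≤ 18|B₁|C₀²`.  (iii) The classical gradient is a weak gradient, and Pineau–Vicol's Lemma 7.1
(`exists_forall_iteratedFDeriv_le_of_typeI`) gives `|∇u| ≤ K max{|x|,√(−t)}⁻²`, square
integrable on `Q((0,0),1)`.  (iv) `p − c = Q[u(t)]`, and by self-similar scaling of the slices
and the global `L²` bound of the pressure potential on the decay class (tools file),
`∫_{B₁}|Q[u(t)]|^{3/2} ≲ (−t)^{−3/8}`, integrable on `(−1, 0)`.

## References

* D. Albritton, T. Barker, *On local Type I singularities of the Navier–Stokes equations and
  Liouville theorems*, J. Math. Fluid Mech. 21 (2019) = arXiv:1811.00502, §1 and Def. 2.1.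
  [AlbrittonBarker2019]
* B. Pineau, V. Vicol, arXiv:2607.09619 (2026), (1.7), Remark 1.2, Lemma 7.1. [PineauVicol2026]
* L. Caffarelli, R. Kohn, L. Nirenberg, Comm. Pure Appl. Math. 35 (1982), §2.
  [CaffarelliKohnNirenberg1982]
-/

noncomputable section

-- the registered stub namespace repeats the summit name `NavierStokesRegularity` (summit = problem)
set_option linter.dupNamespace false

namespace Summit.NavierStokesRegularity.NavierStokesRegularity.Theorems.FrequencyRigidity.ScaledEnergySplit

open Literature.Analysis.FluidPDE Literature.Analysis.FluidPDE.PineauVicol2026 MeasureTheory Set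
  Filter Topology Function Metric TopologicalSpace
open scoped ENNReal NNReal ContDiff

-- nested operator types `ℝ³ →L[ℝ] ℝ³ →L[ℝ] ℝ`
set_option maxSynthPendingDepth 3

variable {u : ℝ → EuclideanSpace ℝ (Fin 3) → EuclideanSpace ℝ (Fin 3)}
  {p : ℝ → EuclideanSpace ℝ (Fin 3) → ℝ} {C₀ : ℝ}

/-! ## The Type I bound of a decaying rotated self-similar flow -/

/-- **Remark 1.2 of Pineau–Vicol for all `t < 0`.** If `u(t) = pvAnsatz α U (t)` for `t < 0`
with a time-independent profile obeying `‖U(y)‖ ≤ C₀/(1+‖y‖)`, then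
`‖u(t,x)‖ ≤ C₀/(‖x‖ + √(−t))` for all `t < 0` (`‖u(t,x)‖ = (−t)^{−1/2}‖U(y)‖`,
`‖y‖ = ‖x‖/√(−t)`, rotations being isometries). [cite: PineauVicol2026, Remark 1.2 (pp. 3–4)] -/
theorem rss_typeI_of_profile_decay {α : ℝ} {U : EuclideanSpace ℝ (Fin 3) → EuclideanSpace ℝ (Fin 3)}
    (hA : ∀ t ∈ Iio (0 : ℝ), ∀ x, u t x = pvAnsatz α (fun y _ => U y) t x)
    (hU : ∀ y, ‖U y‖ ≤ C₀ / (1 + ‖y‖)) :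
    ∀ t ∈ Iio (0 : ℝ), ∀ x, ‖u t x‖ ≤ C₀ / (‖x‖ + Real.sqrt (-t)) := by
  intro t ht x
  have hr : 0 < Real.sqrt (-t) := Real.sqrt_pos.2 (neg_pos.2 ht)
  rw [hA t ht x, norm_pvAnsatz]
  have hy := hU (rotZ (-(α * -Real.log (-t))) ((Real.sqrt (-t))⁻¹ • x))
  rw [norm_rotZ, norm_smul, norm_inv, Real.norm_of_nonneg hr.le] at hy
  have h1 : ‖x‖ + Real.sqrt (-t) ≠ 0 := by positivity
  have h2 : 1 + (Real.sqrt (-t))⁻¹ * ‖x‖ ≠ 0 := by positivity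
  have h3 : Real.sqrt (-t) ≠ 0 := hr.ne'
  calc (Real.sqrt (-t))⁻¹ * ‖U (rotZ (-(α * -Real.log (-t))) ((Real.sqrt (-t))⁻¹ • x))‖
      ≤ (Real.sqrt (-t))⁻¹ * (C₀ / (1 + (Real.sqrt (-t))⁻¹ * ‖x‖)) :=
        mul_le_mul_of_nonneg_left hy (inv_nonneg.2 hr.le)
    _ = C₀ / (‖x‖ + Real.sqrt (-t)) := by
        field_simp
        ring

/-! ## The scale-invariant energy on balls -/

/-- **Energy on balls for Type I fields.** If `‖v(x)‖ ≤ C₀/(‖x‖ + s)` with `s > 0`, then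
`∫_{B(x₀,r)} ‖v‖² ≤ 18 |B₁| C₀² r` for every ball: if `‖x₀‖ ≤ 2r` compare with
`∫_{B(0,3r)} C₀²‖x‖⁻² = 9|B₁|C₀² r`; otherwise `‖x‖ ≥ r` on the ball and `‖v‖² ≤ C₀²/r²`.
[folklore] -/
theorem rss_lintegral_ball_enorm_sq_le {v : EuclideanSpace ℝ (Fin 3) → EuclideanSpace ℝ (Fin 3)}
    {s : ℝ} (hs : 0 < s) (hv : ∀ x, ‖v x‖ ≤ C₀ / (‖x‖ + s)) (x₀ : EuclideanSpace ℝ (Fin 3))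
    {r : ℝ} (hr : 0 < r) :
    ∫⁻ x in ball x₀ r, ‖v x‖ₑ ^ 2 ≤ ENNReal.ofReal
      (18 * (volume : Measure (EuclideanSpace ℝ (Fin 3))).real (ball 0 1) * C₀ ^ 2 * r) := by
  have hC : 0 ≤ C₀ := by
    have h := (norm_nonneg _).trans (hv 0)
    rw [norm_zero, zero_add] at h
    exact (div_nonneg_iff.1 h).elim (fun h => h.1) fun h => absurd h.2 (not_le.2 hs)
  set V₁ := (volume : Measure (EuclideanSpace ℝ (Fin 3))).real (ball 0 1) with hV₁
  have hV₁0 : 0 ≤ V₁ := measureReal_nonneg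
  have e : ∀ x, ‖v x‖ₑ ^ 2 = ENNReal.ofReal (‖v x‖ ^ 2) := fun x => by
    rw [← ofReal_norm, ENNReal.ofReal_pow (norm_nonneg _)]
  by_cases hx₀ : ‖x₀‖ ≤ 2 * r
  · have hsub : ball x₀ r ⊆ ball (0 : EuclideanSpace ℝ (Fin 3)) (3 * r) := by
      intro x hx
      rw [mem_ball, dist_eq_norm] at hx
      rw [mem_ball_zero_iff]
      have := norm_le_norm_add_norm_sub' x x₀
      linarith
    have h0 : ∀ᵐ x ∂(volume.restrict (ball (0 : EuclideanSpace ℝ (Fin 3)) (3 * r))),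
        x ∉ ({0} : Set (EuclideanSpace ℝ (Fin 3))) :=
      ae_restrict_of_ae (measure_eq_zero_iff_ae_notMem.1 (measure_singleton _))
    calc ∫⁻ x in ball x₀ r, ‖v x‖ₑ ^ 2
        ≤ ∫⁻ x in ball (0 : EuclideanSpace ℝ (Fin 3)) (3 * r), ‖v x‖ₑ ^ 2 :=
          lintegral_mono_set hsub
      _ ≤ ∫⁻ x in ball (0 : EuclideanSpace ℝ (Fin 3)) (3 * r),
            ENNReal.ofReal (C₀ ^ 2) * ENNReal.ofReal (‖x‖ ^ (-(2 : ℝ))) := by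
          refine lintegral_mono_ae ?_
          filter_upwards [h0] with x hx
          rw [mem_singleton_iff] at hx
          have hxpos : 0 < ‖x‖ := norm_pos_iff.2 hx
          rw [e, ← ENNReal.ofReal_mul (sq_nonneg _)]
          refine ENNReal.ofReal_le_ofReal ?_
          have h1 : ‖v x‖ ≤ C₀ / ‖x‖ :=
            (hv x).trans (div_le_div_of_nonneg_left hC hxpos (by linarith))
          calc ‖v x‖ ^ 2 ≤ (C₀ / ‖x‖) ^ 2 := pow_le_pow_left₀ (norm_nonneg _) h1 2
            _ = C₀ ^ 2 * ‖x‖ ^ (-(2 : ℝ)) := by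
                rw [div_pow, Real.rpow_neg (norm_nonneg _), Real.rpow_two, div_eq_mul_inv]
      _ = ENNReal.ofReal (C₀ ^ 2) * ENNReal.ofReal (3 * V₁ * ((3 * r) ^ (3 - 2 : ℝ) / (3 - 2))) := by
          rw [lintegral_const_mul' _ _ ENNReal.ofReal_ne_top,
            NewtonPotentialHolder.lintegral_ball_norm_rpow_neg (by norm_num) (by positivity)]
      _ = ENNReal.ofReal (9 * V₁ * C₀ ^ 2 * r) := by
          rw [← ENNReal.ofReal_mul (sq_nonneg _)]
          congr 1
          norm_num
          ring
      _ ≤ _ := ENNReal.ofReal_le_ofReal (by nlinarith [mul_nonneg (mul_nonneg hV₁0 (sq_nonneg C₀)) hr.le])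
  · rw [not_le] at hx₀
    have hbd : ∀ x ∈ ball x₀ r, ‖v x‖ₑ ^ 2 ≤ ENNReal.ofReal (C₀ ^ 2 / r ^ 2) := by
      intro x hx
      rw [mem_ball, dist_eq_norm] at hx
      have hxr : r ≤ ‖x‖ := by
        have := norm_sub_norm_le x₀ x
        rw [← norm_neg, neg_sub] at hx
        linarith
      rw [e]
      refine ENNReal.ofReal_le_ofReal ?_
      have h1 : ‖v x‖ ≤ C₀ / r := (hv x).trans (div_le_div_of_nonneg_left hC hr (by linarith))
      calc ‖v x‖ ^ 2 ≤ (C₀ / r) ^ 2 := pow_le_pow_left₀ (norm_nonneg _) h1 2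
        _ = C₀ ^ 2 / r ^ 2 := by rw [div_pow]
    calc ∫⁻ x in ball x₀ r, ‖v x‖ₑ ^ 2
        ≤ ∫⁻ x in ball x₀ r, ENNReal.ofReal (C₀ ^ 2 / r ^ 2) := setLIntegral_mono' measurableSet_ball hbd
      _ = ENNReal.ofReal (C₀ ^ 2 / r ^ 2) * (ENNReal.ofReal (r ^ 3) * ENNReal.ofReal V₁) := by
          rw [setLIntegral_const, Measure.addHaar_ball_of_pos _ _ hr, finrank_euclideanSpace_fin, hV₁,
            ofReal_measureReal]
      _ = ENNReal.ofReal (V₁ * C₀ ^ 2 * r) := by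
          rw [← ENNReal.ofReal_mul (by positivity), ← ENNReal.ofReal_mul (by positivity)]
          congr 1
          field_simp
      _ ≤ _ := ENNReal.ofReal_le_ofReal (by nlinarith [mul_nonneg (mul_nonneg hV₁0 (sq_nonneg C₀)) hr.le])

/-! ## Finite dissipation on the unit parabolic ball (PV Lemma 7.1) -/

/-- The unit parabolic ball `Q((0,0),1) = (−1,0) × B₁` as a product, at the level of the
restricted Lebesgue measure. [folklore] -/
theorem rss_restrict_parabolicCylinder_one :
    (volume.restrict (parabolicCylinder 1 (0 : ℝ × EuclideanSpace ℝ (Fin 3)))) =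
      (volume.restrict (Ioo (-1 : ℝ) 0)).prod
        (volume.restrict (ball (0 : EuclideanSpace ℝ (Fin 3)) 1)) := by
  rw [parabolicCylinder, Measure.volume_eq_prod, Measure.prod_restrict]
  simp

/-- **Finite dissipation of Type I classical solutions in the unit parabolic ball.** For a
classical solution on `(−∞,0)` with `‖u(t,x)‖ ≤ C₀/(‖x‖ + √(−t))`, Pineau–Vicol's Lemma 7.1
in physical variables (`exists_forall_iteratedFDeriv_le_of_typeI`, `n = 1`) gives
`‖∇u(t,x)‖ ≤ K max{‖x‖, √(−t)}⁻²`, and `max{‖x‖,√(−t)}⁻⁴ ≤ (−t)^{−3/4} ‖x‖^{−5/2}` is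
integrable on `(−1,0) × B₁` (Tonelli). [cite: PineauVicol2026, Lemma 7.1] -/
theorem rss_lintegral_frobeniusNormSq_fderiv_lt_top
    (hsol : IsClassicalNSSolutionOn (Iio (0 : ℝ)) 1 0 u p)
    (hI : ∀ t ∈ Iio (0 : ℝ), ∀ x, ‖u t x‖ ≤ C₀ / (‖x‖ + Real.sqrt (-t))) :
    ∫⁻ w in parabolicCylinder 1 (0 : ℝ × EuclideanSpace ℝ (Fin 3)),
      ENNReal.ofReal (frobeniusNormSq (fderiv ℝ (u w.1) w.2)) < ⊤ := by
  obtain ⟨K, hK0, hK⟩ := exists_forall_iteratedFDeriv_le_of_typeI 1 C₀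
  set V₁ : ℝ := (volume : Measure (EuclideanSpace ℝ (Fin 3))).real (ball 0 1) with hV₁
  have hpt : ∀ t, t < 0 → ∀ x : EuclideanSpace ℝ (Fin 3), x ≠ 0 →
      ENNReal.ofReal (frobeniusNormSq (fderiv ℝ (u t) x)) ≤
        ENNReal.ofReal (3 * K ^ 2 * (-t) ^ (-(3 / 4 : ℝ))) *
          ENNReal.ofReal (‖x‖ ^ (-(5 / 2 : ℝ))) := by
    intro t ht x hx
    have hs : 0 < Real.sqrt (-t) := Real.sqrt_pos.2 (neg_pos.2 ht)
    have ha : 0 < ‖x‖ := norm_pos_iff.2 hx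
    have hm : 0 < max ‖x‖ (Real.sqrt (-t)) := lt_max_of_lt_right hs
    have h1 : ‖fderiv ℝ (u t) x‖ ≤ K * (max ‖x‖ (Real.sqrt (-t)))⁻¹ ^ 2 := by
      have h := hK u p hsol hI t ht x
      rwa [← norm_iteratedFDeriv_fderiv, norm_iteratedFDeriv_zero] at h
    have h2 : frobeniusNormSq (fderiv ℝ (u t) x) ≤ 3 * ‖fderiv ℝ (u t) x‖ ^ 2 := by
      have := frobeniusNormSq_le_finrank_mul_sq_norm (fderiv ℝ (u t) x)
      rwa [finrank_euclideanSpace_fin, Nat.cast_ofNat] at this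
    have h3 : ((max ‖x‖ (Real.sqrt (-t)))⁻¹ ^ 2) ^ 2 ≤
        (-t) ^ (-(3 / 4 : ℝ)) * ‖x‖ ^ (-(5 / 2 : ℝ)) := by
      have e1 : ((max ‖x‖ (Real.sqrt (-t)))⁻¹ ^ 2) ^ 2 =
          max ‖x‖ (Real.sqrt (-t)) ^ (-(3 / 2 : ℝ)) * max ‖x‖ (Real.sqrt (-t)) ^ (-(5 / 2 : ℝ)) := by
        rw [← Real.rpow_add hm, show (-(3 / 2 : ℝ)) + (-(5 / 2 : ℝ)) = -((4 : ℕ) : ℝ) by norm_num,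
          Real.rpow_neg hm.le, Real.rpow_natCast, inv_pow]
        ring
      have e2 : (-t) ^ (-(3 / 4 : ℝ)) = Real.sqrt (-t) ^ (-(3 / 2 : ℝ)) := by
        rw [Real.sqrt_eq_rpow, ← Real.rpow_mul (neg_pos.2 ht).le]
        norm_num
      rw [e1, e2]
      refine mul_le_mul ?_ ?_ (by positivity) (by positivity)
      · exact Real.rpow_le_rpow_of_nonpos hs (le_max_right _ _) (by norm_num)
      · exact Real.rpow_le_rpow_of_nonpos ha (le_max_left _ _) (by norm_num)
    rw [← ENNReal.ofReal_mul (mul_nonneg (by positivity) (Real.rpow_nonneg (neg_pos.2 ht).le _))]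
    refine ENNReal.ofReal_le_ofReal (h2.trans ?_)
    calc 3 * ‖fderiv ℝ (u t) x‖ ^ 2 ≤ 3 * (K * (max ‖x‖ (Real.sqrt (-t)))⁻¹ ^ 2) ^ 2 := by gcongr
      _ = 3 * K ^ 2 * ((max ‖x‖ (Real.sqrt (-t)))⁻¹ ^ 2) ^ 2 := by ring
      _ ≤ 3 * K ^ 2 * ((-t) ^ (-(3 / 4 : ℝ)) * ‖x‖ ^ (-(5 / 2 : ℝ))) := by gcongr
      _ = _ := by ring
  rw [rss_restrict_parabolicCylinder_one]
  refine (lintegral_prod_le _).trans_lt ?_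
  have h0 : ∀ᵐ x ∂(volume.restrict (ball (0 : EuclideanSpace ℝ (Fin 3)) 1)),
      x ∉ ({0} : Set (EuclideanSpace ℝ (Fin 3))) :=
    ae_restrict_of_ae (measure_eq_zero_iff_ae_notMem.1 (measure_singleton _))
  set I₁ : ℝ≥0∞ := ENNReal.ofReal (3 * V₁ * ((1 : ℝ) ^ (3 - 5 / 2 : ℝ) / (3 - 5 / 2))) with hI₁
  have hinner : ∀ t ∈ Ioo (-1 : ℝ) 0, ∫⁻ x in ball (0 : EuclideanSpace ℝ (Fin 3)) 1,
      ENNReal.ofReal (frobeniusNormSq (fderiv ℝ (u t) x)) ≤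
        ENNReal.ofReal (3 * K ^ 2 * (-t) ^ (-(3 / 4 : ℝ))) * I₁ := by
    intro t ht
    rw [hI₁, ← NewtonPotentialHolder.lintegral_ball_norm_rpow_neg (by norm_num) one_pos,
      ← lintegral_const_mul' _ _ ENNReal.ofReal_ne_top]
    refine lintegral_mono_ae ?_
    filter_upwards [h0] with x hx
    exact hpt t ht.2 x hx
  calc ∫⁻ t in Ioo (-1 : ℝ) 0, ∫⁻ x in ball (0 : EuclideanSpace ℝ (Fin 3)) 1,
        ENNReal.ofReal (frobeniusNormSq (fderiv ℝ (u (t, x).1) (t, x).2))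
      ≤ ∫⁻ t in Ioo (-1 : ℝ) 0, ENNReal.ofReal ((-t) ^ (-(3 / 4 : ℝ))) *
          (ENNReal.ofReal (3 * K ^ 2) * I₁) := by
        refine lintegral_mono_ae ?_
        filter_upwards [ae_restrict_mem measurableSet_Ioo] with t ht
        refine (hinner t ht).trans (le_of_eq ?_)
        rw [ENNReal.ofReal_mul (by positivity : (0 : ℝ) ≤ 3 * K ^ 2)]
        ring
    _ < ⊤ := by
        rw [lintegral_mul_const' _ _ (ENNReal.mul_ne_top ENNReal.ofReal_ne_top ENNReal.ofReal_ne_top)]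
        exact ENNReal.mul_lt_top (rss_lintegral_Ioo_neg_rpow_lt_top (by norm_num))
          (ENNReal.mul_lt_top ENNReal.ofReal_lt_top ENNReal.ofReal_lt_top)

/-! ## Suitability with the gauged pressure, and the pressure class -/

/-- The unit parabolic ball lies in the lower half space `(−∞,0) × ℝ³`. [folklore] -/
theorem rss_parabolicCylinder_one_subset :
    ((parabolicCylinderOpens 1 (0 : ℝ × EuclideanSpace ℝ (Fin 3)) :
        Opens (ℝ × EuclideanSpace ℝ (Fin 3))) : Set (ℝ × EuclideanSpace ℝ (Fin 3))) ⊆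
      Iio (0 : ℝ) ×ˢ univ := by
  intro w hw
  rw [coe_parabolicCylinderOpens, mem_parabolicCylinder] at hw
  exact ⟨by simpa using hw.1.2, mem_univ _⟩

/-- **Suitability of `(u, p − c)` on the open unit parabolic ball.** A classical Type I solution
on `(−∞, 0)` is a suitable weak solution on `Q((0,0),1)` (`isSuitableWeakSolutionOn_of_contDiffOn`,
CKN 1982 §2), and so is `(u, p − c)` for the time gauge `c(t) = p(t,0) − Q[u(t)](0)`, which is
locally integrable and locally `L^{3/2}` there (`IsSuitableWeakSolutionOn.sub_pressure`).
[cite: CaffarelliKohnNirenberg1982, §2] -/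
theorem rss_isSuitableWeakSolutionOn_gauged (hsol : IsClassicalNSSolutionOn (Iio (0 : ℝ)) 1 0 u p)
    (hI : ∀ t ∈ Iio (0 : ℝ), ∀ x, ‖u t x‖ ≤ C₀ / (‖x‖ + Real.sqrt (-t))) :
    IsSuitableWeakSolutionOn (parabolicCylinderOpens 1 (0 : ℝ × EuclideanSpace ℝ (Fin 3))) 1 0 u
      (fun t x => p t x - (p t 0 - pressurePotential (u t) 0)) := by
  have hu2 : ContDiffOn ℝ 2 (uncurry u) (Iio (0 : ℝ) ×ˢ univ) :=
    hsol.smooth_velocity.of_le (by norm_cast)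
  have hp1 : ContDiffOn ℝ 1 (uncurry p) (Iio (0 : ℝ) ×ˢ univ) :=
    hsol.smooth_pressure.of_le (by norm_cast)
  have hf : ContinuousOn
      (uncurry (0 : ℝ → EuclideanSpace ℝ (Fin 3) → EuclideanSpace ℝ (Fin 3)))
      (Iio (0 : ℝ) ×ˢ univ) := continuousOn_const
  have h0 : IsSuitableWeakSolutionOn (parabolicCylinderOpens 1 (0 : ℝ × EuclideanSpace ℝ (Fin 3)))
      1 0 u p := by
    refine isSuitableWeakSolutionOn_of_contDiffOn isOpen_Iio rss_parabolicCylinder_one_subset hu2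
      hp1 hf (fun t ht x => ?_) hsol.divFree
    have hm := hsol.momentum t ht x
    rwa [timeDerivWithin_eq_deriv isOpen_Iio ht, ← timeDeriv_apply] at hm
  refine h0.sub_pressure ?_ fun K hK hKc => (rss_gauge_integrableOn_compact hsol hI hK hKc).2
  exact (locallyIntegrableOn_iff (isOpen_parabolicCylinder 1 _).isLocallyClosed).2
    fun K hK hKc => (rss_gauge_integrableOn_compact hsol hI hK hKc).1

/-- **The gauged pressure lies in `L^{3/2}(Q((0,0),1))`.** For `t ∈ (−1, 0)` the slice
`u(t) = λ V(λ ·)`, `λ = (−t)^{−1/2}`, has the smooth profile `V(y) = √(−t) u(t, √(−t) y)` in the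
decay class `‖V(y)‖ ≤ C₀/(1+‖y‖)` (Type I), so `p(t,·) − c(t) = Q[u(t)]` has
`∫_{B₁} |Q[u(t)]|^{3/2} ≤ (K C₀⁴)^{3/4} |B₁|^{1/4} (−t)^{−3/8}`
(`rss_lintegral_ball_rpow_pressurePotential_le`), which is integrable on `(−1, 0)`. [folklore] -/
theorem rss_lintegral_gauged_pressure_lt_top (hsol : IsClassicalNSSolutionOn (Iio (0 : ℝ)) 1 0 u p)
    (hI : ∀ t ∈ Iio (0 : ℝ), ∀ x, ‖u t x‖ ≤ C₀ / (‖x‖ + Real.sqrt (-t))) :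
    ∫⁻ z in parabolicCylinder 1 (0 : ℝ × EuclideanSpace ℝ (Fin 3)),
      ‖p z.1 z.2 - (p z.1 0 - pressurePotential (u z.1) 0)‖ₑ ^ (3 / 2 : ℝ) < ⊤ := by
  obtain ⟨K, -, hK⟩ := rss_lintegral_enorm_sq_pressurePotential_le
  set V₁ : ℝ≥0∞ := volume (ball (0 : EuclideanSpace ℝ (Fin 3)) 1) with hV₁
  have hslice : ∀ t ∈ Ioo (-1 : ℝ) 0, ∫⁻ x in ball (0 : EuclideanSpace ℝ (Fin 3)) 1,
      ‖p t x - (p t 0 - pressurePotential (u t) 0)‖ₑ ^ (3 / 2 : ℝ) ≤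
        ENNReal.ofReal ((-t) ^ (-(1 / 2 : ℝ)) * (K * C₀ ^ 4)) ^ (3 / 4 : ℝ) * V₁ ^ (1 / 4 : ℝ) := by
    intro t ht
    have ht0 : t < 0 := ht.2
    have hs : 0 < Real.sqrt (-t) := Real.sqrt_pos.2 (neg_pos.2 ht0)
    simp only [rss_pressure_sub_gauge_eq hsol hI ht0]
    have hdec₁ := rss_decay_of_typeI hI hs (le_of_eq (by rw [Real.sq_sqrt (neg_pos.2 ht0).le, neg_neg]))
    have hV : ∀ y, ‖(Real.sqrt (-t))⁻¹⁻¹ • u t ((Real.sqrt (-t))⁻¹⁻¹ • y)‖ ≤ C₀ / (1 + ‖y‖) := by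
      intro y
      rw [inv_inv, norm_smul, Real.norm_of_nonneg hs.le]
      have h := hI t ht0 (Real.sqrt (-t) • y)
      rw [norm_smul, Real.norm_of_nonneg hs.le] at h
      have hden : 0 < Real.sqrt (-t) * ‖y‖ + Real.sqrt (-t) := by positivity
      calc Real.sqrt (-t) * ‖u t (Real.sqrt (-t) • y)‖
          ≤ Real.sqrt (-t) * (C₀ / (Real.sqrt (-t) * ‖y‖ + Real.sqrt (-t))) :=
            mul_le_mul_of_nonneg_left h hs.le
        _ = C₀ / (1 + ‖y‖) := by field_simp; ring
    have key := rss_lintegral_ball_rpow_pressurePotential_le hK (hsol.contDiff_velocity ht0)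
      (inv_pos.2 hs) hdec₁ hV
    rwa [Real.sqrt_eq_rpow, ← Real.rpow_neg (neg_pos.2 ht0).le] at key
  rw [rss_restrict_parabolicCylinder_one]
  refine (lintegral_prod_le _).trans_lt ?_
  calc ∫⁻ t in Ioo (-1 : ℝ) 0, ∫⁻ x in ball (0 : EuclideanSpace ℝ (Fin 3)) 1,
        ‖p (t, x).1 (t, x).2 - (p (t, x).1 0 - pressurePotential (u (t, x).1) 0)‖ₑ ^ (3 / 2 : ℝ)
      ≤ ∫⁻ t in Ioo (-1 : ℝ) 0,
          ENNReal.ofReal ((-t) ^ (-(1 / 2 : ℝ)) * (K * C₀ ^ 4)) ^ (3 / 4 : ℝ) * V₁ ^ (1 / 4 : ℝ) := by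
        refine lintegral_mono_ae ?_
        filter_upwards [ae_restrict_mem measurableSet_Ioo] with t ht
        exact hslice t ht
    _ = ∫⁻ t in Ioo (-1 : ℝ) 0, ENNReal.ofReal ((-t) ^ (-(3 / 8 : ℝ))) *
          (ENNReal.ofReal (K * C₀ ^ 4) ^ (3 / 4 : ℝ) * V₁ ^ (1 / 4 : ℝ)) := by
        refine setLIntegral_congr_fun measurableSet_Ioo fun t ht => ?_
        have ht' : 0 ≤ -t := (neg_pos.2 ht.2).le
        rw [ENNReal.ofReal_mul (Real.rpow_nonneg ht' _),
          ENNReal.mul_rpow_of_nonneg _ _ (by norm_num : (0 : ℝ) ≤ 3 / 4),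
          ENNReal.ofReal_rpow_of_nonneg (Real.rpow_nonneg ht' _) (by norm_num : (0 : ℝ) ≤ 3 / 4),
          ← Real.rpow_mul ht']
        norm_num
        ring
    _ < ⊤ := by
        rw [lintegral_mul_const' _ _ (ENNReal.mul_ne_top
          (ENNReal.rpow_ne_top_of_nonneg (by norm_num) ENNReal.ofReal_ne_top)
          (ENNReal.rpow_ne_top_of_nonneg (by norm_num) measure_ball_lt_top.ne))]
        refine ENNReal.mul_lt_top (rss_lintegral_Ioo_neg_rpow_lt_top (by norm_num)) ?_
        exact (ENNReal.mul_lt_top (ENNReal.rpow_lt_top_of_nonneg (by norm_num) ENNReal.ofReal_ne_top)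
          (ENNReal.rpow_lt_top_of_nonneg (by norm_num) measure_ball_lt_top.ne))

/-! ## The stub -/

/-- **Stub `stub_rssDecaySuitableInBall`.** A classical unit-viscosity Navier–Stokes flow on
`(−∞, 0)` of rotated self-similar form `u = pvAnsatz α U` with a decaying profile
`‖U(y)‖ ≤ C₀/(1+‖y‖)` is, for the time gauge `c(t) = p(t,0) − Q[u(t)](0)` of the pressure, a
suitable weak solution in the unit parabolic ball `Q((0,0),1)` in Albritton–Barker's class
(Def. 2.1): suitability of the classical pair and the gauge freedom (CKN 1982 §2), the energy
class and the bound on the scaled energies `A` of all parabolic sub-balls from the Type I bound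
`‖u‖ ≤ C₀/(‖x‖ + √(−t))` (`∫_{B(x₀,r)} ‖u‖² ≤ 18|B₁|C₀² r`), the dissipation from
Pineau–Vicol's Lemma 7.1, and the pressure class `p − c = Q[u(t)] ∈ L^{3/2}(Q((0,0),1))` from
the global `L²` bound of the pressure potential on the decay class and self-similar scaling.
[cite: AlbrittonBarker2019, Def. 2.1] -/
theorem stub_rssDecaySuitableInBall : ∀ (α C₀ : ℝ) (U : EuclideanSpace ℝ (Fin 3) → EuclideanSpace ℝ (Fin 3)) (u : ℝ → EuclideanSpace ℝ (Fin 3) → EuclideanSpace ℝ (Fin 3)) (p : ℝ → EuclideanSpace ℝ (Fin 3) → ℝ), Literature.Analysis.FluidPDE.IsClassicalNSSolutionOn (Set.Iio 0) 1 0 u p → (∀ t ∈ Set.Iio (0:ℝ), ∀ x, u t x = Literature.Analysis.FluidPDE.pvAnsatz α (fun y _ => U y) t x) → (∀ y, ‖U y‖ ≤ C₀ / (1 + ‖y‖)) → ∃ c : ℝ → ℝ, Literature.Analysis.FluidPDE.IsSuitableWeakSolutionInBall 1 0 u (fun t x => p t x - c t) ∧ ∃ M : NNReal, ∀ (r : ℝ)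 (z : ℝ × EuclideanSpace ℝ (Fin 3)), 0 < r → Literature.Analysis.FluidPDE.parabolicCylinder r z ⊆ Literature.Analysis.FluidPDE.parabolicCylinder 1 0 → Literature.Analysis.FluidPDE.cknAEss r z u ≤ M := by
  intro α C₀ U u p hsol hA hU
  have hI := rss_typeI_of_profile_decay hA hU
  set V₁ : ℝ := (volume : Measure (EuclideanSpace ℝ (Fin 3))).real (ball 0 1) with hV₁
  have hE : ∀ t, t < 0 → ∀ (x₀ : EuclideanSpace ℝ (Fin 3)) (r : ℝ), 0 < r →
      ∫⁻ x in ball x₀ r, ‖u t x‖ₑ ^ 2 ≤ ENNReal.ofReal (18 * V₁ * C₀ ^ 2 * r) :=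
    fun t ht x₀ r hr => rss_lintegral_ball_enorm_sq_le (Real.sqrt_pos.2 (neg_pos.2 ht)) (hI t ht) x₀ hr
  refine ⟨fun t => p t 0 - pressurePotential (u t) 0, ⟨rss_isSuitableWeakSolutionOn_gauged hsol hI,
    ?_, ⟨fun t x => fderiv ℝ (u t) x, ?_, rss_lintegral_frobeniusNormSq_fderiv_lt_top hsol hI⟩, ?_⟩, ?_⟩
  · refine ⟨(ENNReal.ofReal (18 * V₁ * C₀ ^ 2 * 1)).toNNReal, ?_⟩
    rw [ENNReal.coe_toNNReal ENNReal.ofReal_ne_top]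
    filter_upwards [ae_restrict_mem measurableSet_Ioo] with t ht
    have ht0 : t < 0 := by simpa using ht.2
    simpa using hE t ht0 0 1 one_pos
  · exact hasWeakSpatialGradientOn_of_contDiffOn isOpen_Iio rss_parabolicCylinder_one_subset
      (hsol.smooth_velocity.of_le (by norm_cast))
  · refine ⟨(rss_isSuitableWeakSolutionOn_gauged hsol hI).distributional.2.2.1.aestronglyMeasurable, ?_⟩
    have h32 : ((3 : ℝ≥0∞) / 2).toReal = 3 / 2 := by rw [ENNReal.toReal_div]; norm_num
    have h32top : (3 : ℝ≥0∞) / 2 ≠ ⊤ := (ENNReal.div_lt_top (by simp) (by simp)).ne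
    rw [eLpNorm_eq_lintegral_rpow_enorm_toReal (by norm_num) h32top, h32]
    exact ENNReal.rpow_lt_top_of_nonneg (by positivity)
      (rss_lintegral_gauged_pressure_lt_top hsol hI).ne
  · refine ⟨(ENNReal.ofReal (18 * V₁ * C₀ ^ 2)).toNNReal, fun r z hr hz => ?_⟩
    rw [ENNReal.coe_toNNReal ENNReal.ofReal_ne_top]
    refine essSup_le_of_ae_le _ ?_
    filter_upwards [ae_restrict_mem measurableSet_Ioo] with t ht
    have hmem : ((t, z.2) : ℝ × EuclideanSpace ℝ (Fin 3)) ∈ parabolicCylinder r z := by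
      rw [mem_parabolicCylinder]; exact ⟨ht, by simpa using hr⟩
    have ht0 : t < 0 := by simpa using (mem_parabolicCylinder.1 (hz hmem)).1.2
    have hr0 : ENNReal.ofReal r ≠ 0 := (ENNReal.ofReal_pos.2 hr).ne'
    calc (ENNReal.ofReal r)⁻¹ * ∫⁻ x in ball z.2 r, ‖u t x‖ₑ ^ 2
        ≤ (ENNReal.ofReal r)⁻¹ * ENNReal.ofReal (18 * V₁ * C₀ ^ 2 * r) :=
          mul_le_mul' le_rfl (hE t ht0 z.2 r hr)
      _ = ENNReal.ofReal (18 * V₁ * C₀ ^ 2) := by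
          rw [ENNReal.ofReal_mul' hr.le, ← mul_assoc, mul_comm (ENNReal.ofReal r)⁻¹, mul_assoc,
            ENNReal.inv_mul_cancel hr0 ENNReal.ofReal_ne_top, mul_one]

end Summit.NavierStokesRegularity.NavierStokesRegularity.Theorems.FrequencyRigidity.ScaledEnergySplit
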